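import Literature.Topology.FourManifolds.HomotopySpheres
import Literature.Topology.FourManifolds.ConnectedSumData

/-!
# Stub `stub_chartEmbedding` of line `round-trace-continuity` for crux `OrigamiFoldExistence`
(item stmt-SmoothPoincare4-7844, route route-SmoothPoincare4-SymplecticOrigami)

The registered signature (lead reshape r3; the skeleton's local notation
`E4 := EuclideanSpace ℝ (Fin 4)` expanded), so that the skeleton closes its `stub_chartEmbedding` by
`exact` this theorem.  S-sized chart lemma: every homotopy `4`-sphere `S` receives a smooth
embedding `e : ℝ⁴ → S` of the whole model space.

Proof. `S` is nonempty (a homotopy inverse `𝕊⁴ → S` of `S.nonempty_homotopyEquiv` applied to the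
north pole). Around any point there is a chart `c` of the maximal `C^∞` atlas with `c.target = univ`
(tree `Literature.Topology.FourManifolds.exists_mem_maximalAtlas_target_eq_univ`: shrink `chartAt` to
a ball and compose with Mathlib's diffeomorphism `univBall : ℝ⁴ ≅ ball`), and the inverse of such a
chart is a smooth embedding `ℝ⁴ → S` (tree
`Literature.Topology.FourManifolds.isSmoothEmbedding_symm_of_target_eq_univ`). The statement only
involves `HomotopySphere` and Mathlib's `Manifold.IsSmoothEmbedding`, so no thesis import is needed.
-/

noncomputable section

-- the prescribed namespace `Summit.<P>.<Sub>.…` duplicates `SmoothPoincare4` (P = Sub)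
set_option linter.dupNamespace false

open scoped Manifold ContDiff Topology RealInnerProductSpace
open Set Function

namespace Summit.SmoothPoincare4.SmoothPoincare4.Theorems.OrigamiFoldExistence.RoundTraceContinuity

/-- **Stub `stub_chartEmbedding` (a chart ball).** Every homotopy 4-sphere receives a smooth embedding of
the whole model space `ℝ⁴`. -/
theorem stub_chartEmbedding :
    ∀ S : Literature.Topology.FourManifolds.HomotopySphere 4, ∃ e : EuclideanSpace ℝ (Fin 4) → S.carrier, Manifold.IsSmoothEmbedding (𝓡 4) (𝓡 4) ∞ e := by
  intro S
  obtain ⟨h⟩ := S.nonempty_homotopyEquiv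
  -- `S` is nonempty: the image of the north pole of `𝕊⁴` under a homotopy inverse
  obtain ⟨c, hc, -, hct, -⟩ :=
    Literature.Topology.FourManifolds.exists_mem_maximalAtlas_target_eq_univ
      (E := EuclideanSpace ℝ (Fin 4)) (h.symm ⟨EuclideanSpace.single 0 1, by simp⟩)
  -- a chart of the maximal `C^∞` atlas with target all of `ℝ⁴`: its inverse is a smooth embedding
  exact ⟨c.symm, Literature.Topology.FourManifolds.isSmoothEmbedding_symm_of_target_eq_univ hc hct⟩

end Summit.SmoothPoincare4.SmoothPoincare4.Theorems.OrigamiFoldExistence.RoundTraceContinuity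

end
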